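import Mathlib
import Summits.AtomisticToContinuum.Crystallization.Statement
import Summits.AtomisticToContinuum.Crystallization.Theses.BrittleRungDescent
import Summits.AtomisticToContinuum.Crystallization.Theses.LaminarSixThreeThree
import Summits.AtomisticToContinuum.Crystallization.Theses.HullMinimality
import Summits.AtomisticToContinuum.Crystallization.Theses.PhononSlackCertificates
import Summits.AtomisticToContinuum.Crystallization.Theses.ReggeStarCoercivity
import Summits.AtomisticToContinuum.Crystallization.Theorems.HullMinimalityHullCriterionConverse
import Summits.AtomisticToContinuum.Crystallization.Theorems.ReggeStarCoercivityDefectFreeCrystallizesHullCriterion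
import Summits.AtomisticToContinuum.Crystallization.Theorems.PhononSlackCertificatesWindowOptimality
import Summits.AtomisticToContinuum.Crystallization.Theorems.ChessboardParticlePlanesPeriodicWindowsOfBarlowWindows
import Summits.AtomisticToContinuum.Crystallization.Theorems.PhononSlackCertificatesNearFarGlueRRouteNeeds
import Literature.MathematicalPhysics.StatisticalMechanics.LennardJonesClusters

/-!
# Crux `LJBarlowRigidity` (stmt-AtomisticToContinuum-9206) — LANDED GLUE around the crux (strategist workfile, sorry-free)

Which glue around `LJBarlowRigidity` is already LANDED (all theorems below: axioms propext / Classical.choice / Quot.sound).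
(1) `IsCrystallizing lennardJones 3 → Crystallization` (hullCriterionConverse + windowOptimality +
CrysEnergyLimit + existence); (2) `LaminarBarlowWindows → Crystallization`; (3) hence the crux from
birth's stub 1 ALONE; (4) the crux from `DefectFreeCrystallizes` + an H ⇒ ZeroDefectDensity bridge. -/

open Literature.MathematicalPhysics.StatisticalMechanics Filter
open scoped Classical

namespace Summit.AtomisticToContinuum.Crystallization.Cruxes.LJBarlowRigidity.Probe

/-- (1) The positional conjunct alone decides the sub-problem (all landed). -/
theorem crystallization_of_isCrystallizing (h : IsCrystallizing lennardJones 3) :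
    _root_.Crystallization := by
  have hPW : Summit.AtomisticToContinuum.Crystallization.Theses.HullMinimality.PeriodicWindows :=
    Summit.AtomisticToContinuum.Crystallization.Theorems.hullCriterionConverse_proof h
  have hWO := Summit.AtomisticToContinuum.Crystallization.Theorems.windowOptimality_proof
  unfold Summit.AtomisticToContinuum.Crystallization.Theses.PhononSlackCertificates.WindowOptimality
    at hWO
  obtain ⟨x, hx⟩ : ∃ x : (N : ℕ) → (Fin N → EuclideanSpace ℝ (Fin 3)),
      ∀ N, IsGroundState lennardJones (x N) :=
    ⟨fun N => (LennardJonesGroundStatesExist_holds N).choose,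
      fun N => (LennardJonesGroundStatesExist_holds N).choose_spec⟩
  obtain ⟨P, hP⟩ := hPW x hx
  have hleast : IsLeast (Set.range fun Q : PeriodicConfiguration 3 => Q.energyPerParticle lennardJones)
      (P.energyPerParticle lennardJones) := hWO x hx P hP
  have hinf : (⨅ Q : PeriodicConfiguration 3, Q.energyPerParticle lennardJones) =
      P.energyPerParticle lennardJones := hleast.csInf_eq
  have h0 := Summit.AtomisticToContinuum.Crystallization.Theses.LaminarSixThreeThree.CrysEnergyLimit_holds
  unfold Summit.AtomisticToContinuum.Crystallization.Theses.LaminarSixThreeThree.CrysEnergyLimit at h0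
  rw [hinf] at h0
  exact ⟨⟨P, hleast, h0⟩, h⟩

/-- Hence the sub-problem is equivalent to its positional conjunct. -/
theorem crystallization_iff_isCrystallizing :
    _root_.Crystallization ↔ IsCrystallizing lennardJones 3 :=
  ⟨fun h => h.2, crystallization_of_isCrystallizing⟩

/-- (2) Item 14292 alone decides the sub-problem (all landed). -/
theorem crystallization_of_laminarBarlowWindows
    (h : Summit.AtomisticToContinuum.Crystallization.Theses.LaminarSixThreeThree.LaminarBarlowWindows) :
    _root_.Crystallization :=
  crystallization_of_isCrystallizing
    (Summit.AtomisticToContinuum.Crystallization.Theorems.PrestressSplitKorn.stub_hullCriterion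
      (Summit.AtomisticToContinuum.Crystallization.Theorems.PeriodicWindowsSketch.PeriodicWindows_of_laminarBarlowWindows h))

/-- `H`, the hypothesis of the crux. -/
def LocalBarlowOrder : Prop :=
  (∃ a : ℝ, 0 < a ∧ ∀ x : (N : ℕ) → (Fin N → EuclideanSpace ℝ (Fin 3)), (∀ N, Literature.MathematicalPhysics.StatisticalMechanics.IsGroundState Literature.MathematicalPhysics.StatisticalMechanics.lennardJones (x N)) → Filter.Tendsto (fun N : ℕ => (Nat.card {i : Fin N // ¬ ∀ j : Fin N, dist (x N i) (x N j) ≤ 4 * a → (((∀ l : Fin N, l ≠ j → a * (1 - 1 / 400) ≤ dist (x N j) (x N l) ∧ (dist (x N j) (x N l) ≤ a * (1 + 1 / 400) ∨ 63 / 50 * a ≤ dist (x N j) (x N l))) ∧ Nat.card {l : Fin N // l ≠ j ∧ dist (x N j) (x N l) ≤ a * (1 + 1 / 400)} = 12) ∧ ((∃ e : {k : Fin N // k ≠ j ∧ dist (x N j) (x N k) ≤ a * (1 + 1 / 400)} ≃ {q : EuclideanSpace ℝ (Fin 3) // q ∈ Literature.Geometry.DiscreteGeometry.fccKissingPattern},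 ∀ k k' : {k : Fin N // k ≠ j ∧ dist (x N j) (x N k) ≤ a * (1 + 1 / 400)}, k ≠ k' → (dist (x N k.1) (x N k'.1) ≤ a * (1 + 1 / 400) ↔ dist (e k).1 (e k').1 = 1)) ∨ (∃ e : {k : Fin N // k ≠ j ∧ dist (x N j) (x N k) ≤ a * (1 + 1 / 400)} ≃ {q : EuclideanSpace ℝ (Fin 3) // q ∈ Literature.Geometry.DiscreteGeometry.hcpKissingPattern}, ∀ k k' : {k : Fin N // k ≠ j ∧ dist (x N j) (x N k) ≤ a * (1 + 1 / 400)}, k ≠ k' → (dist (x N k.1) (x N k'.1) ≤ a * (1 + 1 / 400) ↔ dist (e k).1 (e k').1 = 1))))} : ℝ) / N) Filter.atTop (nhds 0))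

example : Summit.AtomisticToContinuum.Crystallization.Theses.BrittleRungDescent.LJBarlowRigidity ↔
    (LocalBarlowOrder → _root_.Crystallization) := Iff.rfl

/-- (3) The crux from birth's stub 1 ALONE (`H → LaminarBarlowWindows`). -/
theorem LJBarlowRigidity_of_stub1
    (h1 : LocalBarlowOrder →
      Summit.AtomisticToContinuum.Crystallization.Theses.LaminarSixThreeThree.LaminarBarlowWindows) :
    Summit.AtomisticToContinuum.Crystallization.Theses.BrittleRungDescent.LJBarlowRigidity :=
  fun hH => crystallization_of_laminarBarlowWindows (h1 hH)

/-- (3') The crux is equivalent to `H → IsCrystallizing`. -/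
theorem LJBarlowRigidity_iff :
    Summit.AtomisticToContinuum.Crystallization.Theses.BrittleRungDescent.LJBarlowRigidity ↔
    (LocalBarlowOrder → IsCrystallizing lennardJones 3) :=
  ⟨fun h hH => (h hH).2, fun h hH => crystallization_of_isCrystallizing (h hH)⟩

/-- (4) The crux from the sibling crux `DefectFreeCrystallizes` (13603) plus a bridge
`H → ZeroDefectDensity`. -/
theorem LJBarlowRigidity_of_defectFree
    (hbridge : LocalBarlowOrder →
      Summit.AtomisticToContinuum.Crystallization.Theses.ReggeStarCoercivity.ZeroDefectDensity)
    (h13603 : Summit.AtomisticToContinuum.Crystallization.Theses.ReggeStarCoercivity.DefectFreeCrystallizes) :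
    Summit.AtomisticToContinuum.Crystallization.Theses.BrittleRungDescent.LJBarlowRigidity :=
  fun hH => crystallization_of_isCrystallizing (h13603 (hbridge hH))

/-- (5) The crux from the two FRACTION statements of `crystallization_of_fractions` under `H`. -/
theorem LJBarlowRigidity_of_fractions
    (hF1 : LocalBarlowOrder → ∀ x : (N : ℕ) → (Fin N → EuclideanSpace ℝ (Fin 3)),
      (∀ N, IsGroundState lennardJones (x N)) →
      Tendsto (fun N : ℕ =>
        (Nat.card {i : Fin N // ¬ Literature.Geometry.DiscreteGeometry.IsTwoShellGood (1 / 20) (47 / 50) 1 (x N) i} : ℝ) / N) atTop (nhds 0))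
    (hF2 : LocalBarlowOrder → ∀ x : (N : ℕ) → (Fin N → EuclideanSpace ℝ (Fin 3)),
      (∀ N, IsGroundState lennardJones (x N)) → ∀ η : ℝ, 0 < η →
      Tendsto (fun N : ℕ =>
        ((Finset.univ.filter fun i : Fin N => ¬ Summit.AtomisticToContinuum.Crystallization.Theorems.PrestressSplitKorn.LayeredNear η (x N) i).card : ℝ) / N) atTop (nhds 0)) :
    Summit.AtomisticToContinuum.Crystallization.Theses.BrittleRungDescent.LJBarlowRigidity :=
  fun hH => Summit.AtomisticToContinuum.Crystallization.Theorems.PhononSlackCertificatesNearFarGlueR.crystallization_of_fractions (hF1 hH) (hF2 hH)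

end Summit.AtomisticToContinuum.Crystallization.Cruxes.LJBarlowRigidity.Probe
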